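import Summits.Ventures.PercRepro.RankLevelSetLevelSevenRowsFortyEightToFiftyThree
import Summits.Ventures.PercRepro.RankLevelSetLevelSevenRowFortySeven
import Summits.Ventures.PercRepro.RankLevelSetLevelSevenRowFortySix
import Summits.Ventures.PercRepro.RankLevelSetLevelSevenRowFortyFive
import Summits.Ventures.PercRepro.RankLevelSetLevelSevenRowFortyFour

/-!
# PercRepro — THE ROWS `47 … 44` OF LEVEL `7`: C-025 AT `q = 7` FOR EVERY FINITE MATROID AND EVERY `p ≥ 44`, ON THE
TELESCOPING COUNT WITH THE NULLITY SPLIT IN k STEPS (p8, gen 21; a feeder for S4 — the top of the `q = 7` window moves from `48` to `44`)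

Each row from the row above and its own rank: `c025_seven_large_<word> (P ≤ p) : RLS M p 7` is `c025_seven_at_<word>`
(RankLevelSetLevelSevenRow<Word>) at `p = P` and the row `P + 1` above it; the row `48` is `c025_seven_large_forty_eight`
(RankLevelSetLevelSevenRowsFortyEightToFiftyThree). The chain `47 → … → 44`; the literal `C025` body at `44`
(`c025_seven_forty_four`). Axioms: standard.
-/

open scoped Matroid

namespace PercRepro

namespace ThmN

variable {α : Type}

/-- **THEOREM C₇ AT `47`, UNCONDITIONAL OVER THE TREE**: every finite matroid satisfies C-025 at level `7` for every
`p ≥ 47` — the row `47` by `c025_seven_at_forty_seven`, the rows `≥ 48` by `c025_seven_large_forty_eight`. -/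
theorem c025_seven_large_forty_seven (M : Matroid α) [M.Finite] (p : ℕ) (hp : 47 ≤ p) : RLS M p 7 := by
  rcases Nat.lt_or_ge p 48 with h | h
  · have h47 : p = 47 := by omega
    subst h47
    exact c025_seven_at_forty_seven M
  · exact c025_seven_large_forty_eight M p h

/-- **THEOREM C₇ AT `46`, UNCONDITIONAL OVER THE TREE**: every finite matroid satisfies C-025 at level `7` for every
`p ≥ 46` — the row `46` by `c025_seven_at_forty_six`, the rows `≥ 47` by `c025_seven_large_forty_seven`. -/
theorem c025_seven_large_forty_six (M : Matroid α) [M.Finite] (p : ℕ) (hp : 46 ≤ p) : RLS M p 7 := by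
  rcases Nat.lt_or_ge p 47 with h | h
  · have h46 : p = 46 := by omega
    subst h46
    exact c025_seven_at_forty_six M
  · exact c025_seven_large_forty_seven M p h

/-- **THEOREM C₇ AT `45`, UNCONDITIONAL OVER THE TREE**: every finite matroid satisfies C-025 at level `7` for every
`p ≥ 45` — the row `45` by `c025_seven_at_forty_five`, the rows `≥ 46` by `c025_seven_large_forty_six`. -/
theorem c025_seven_large_forty_five (M : Matroid α) [M.Finite] (p : ℕ) (hp : 45 ≤ p) : RLS M p 7 := by
  rcases Nat.lt_or_ge p 46 with h | h
  · have h45 : p = 45 := by omega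
    subst h45
    exact c025_seven_at_forty_five M
  · exact c025_seven_large_forty_six M p h

/-- **THEOREM C₇ AT `44`, UNCONDITIONAL OVER THE TREE**: every finite matroid satisfies C-025 at level `7` for every
`p ≥ 44` — the row `44` by `c025_seven_at_forty_four`, the rows `≥ 45` by `c025_seven_large_forty_five`. -/
theorem c025_seven_large_forty_four (M : Matroid α) [M.Finite] (p : ℕ) (hp : 44 ≤ p) : RLS M p 7 := by
  rcases Nat.lt_or_ge p 45 with h | h
  · have h44 : p = 44 := by omega
    subst h44
    exact c025_seven_at_forty_four M
  · exact c025_seven_large_forty_five M p h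

/-- The same in the literal `C025` body: `phiK p 7 · #U(p, 7) ≤ #Y(p, 7)` for every finite matroid and every `p ≥ 44`. -/
theorem c025_seven_forty_four (M : Matroid α) [M.Finite] (p : ℕ) (hp : 44 ≤ p) :
    phiK p 7 * ({A : Set α | A ⊆ M.E ∧ M.eRk A = (p : ℕ∞) ∧ M.eRk (M.E \ A) = (7 : ℕ∞)}.ncard : ℚ) ≤
      ({A : Set α | A ⊆ M.E ∧ (7 : ℕ∞) < M.eRk A ∧ M.eRk A < (p : ℕ∞)}.ncard : ℚ) :=
  c025_seven_large_forty_four M p hp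

end ThmN

end PercRepro
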